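import Literature.Geometry.Riemannian.ColdingMinicozziEntropyValues
import HarnessLib

/-!
# Low-entropy closed hypersurfaces of `ℝ⁵` are standard spheres (Chodosh–Mantoulidis–Schulze 2025, Cor. 1.5 / Cor. 1.22 for `n = 4`)

Topic `Literature/Geometry/Riemannian`; fact request `wi-12056` of route
`Summit.SmoothPoincare4.SmoothPoincare4.Theses.EntropyLadder` (crux `ThinSpheresBoundTwoHandlebodies`,
support `ThinSpheresStandard`). Source read on the page: O. Chodosh, C. Mantoulidis, F. Schulze,
*Mean curvature flow with generic low-entropy initial data II*, Duke Math. J. (2025),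
arXiv:2309.03856 (held text), §1, verbatim:

> **Corollary 1.5 (Mean curvature flow as a smooth isotopy in low entropy).** Let
> `n ∈ {2, 3, 4, 5}` and `Mⁿ ⊂ ℝⁿ⁺¹` be a closed connected embedded hypersurface.
> (a) If `λ(M) ≤ λ(𝕊ⁿ⁻¹)` then perhaps after a small initial `C^∞` perturbation, the mean
> curvature flow provides a smooth isotopy from `M` to a standard `𝕊ⁿ` in `ℝⁿ⁺¹`.
> (b) If `λ(M) ≤ λ(𝕊ⁿ⁻²)` then perhaps after a small initial `C^∞` perturbation, the mean
> curvature flow with surgery of [Daniels-Holgate] provides a smooth isotopy from `M` to the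
> boundary of a standard handlebody that is either a standard ball `Bⁿ` or a boundary connect sum
> of finitely many `Bⁿ⁻¹ × 𝕊¹`'s.

(= Cor. 1.22 with `Λ = λ(𝕊ⁿ⁻¹)`, resp. `λ(𝕊ⁿ⁻²)`, "unconditionally … when `n ≤ 5`" by Remarks 1.16,
1.18; proof p. 6: Thm. 1.17 gives a perturbation `M'` with `sing_non-gen = ∅` and `λ(M') < Λ`, so in
case (a) only multiplicity-one `𝕊ⁿ`-type singularities occur and "the mean curvature flow is
completely smooth until it becomes a round sphere", in case (b) one adds the surgery of
Daniels-Holgate 2022.) Here `λ` is the Colding–Minicozzi entropy (the tree's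
`gaussianEntropy n A`, `ColdingMinicozziEntropy.lean`: `λ(A) = sup_{p, t>0} (4πt)^{-n/2}
∫_A e^{-‖x-p‖²/4t} d𝓗ⁿ`), and `λ(𝕊ᵏ)` the entropy of the round `k`-sphere, which equals the
entropy of every generalised cylinder `𝕊ᵏ(r) × ℝⁿ⁻ᵏ ⊂ ℝⁿ⁺¹` (the `F`-functional of a product with
a Euclidean factor is the product of the `F`-functionals and `λ(ℝᵐ) = 1`; Colding–Minicozzi 2012,
§0.5 and Lemma 7.10; Stone 1994: `λ(𝕊¹) ≈ 1.5203 > λ(𝕊²) = 4/e ≈ 1.4715 > λ(𝕊³) ≈ 1.4531`).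

## The named fact and its rendering (`n = 4` only — the case the route uses; weaker than print)

`ChodoshMantoulidisSchulze2025_lowEntropy_sphere_four` is the CONJUNCTION of the two
diffeomorphism consequences of Cor. 1.5 for `n = 4`, for a compact connected `C^∞` `4`-manifold
`M` (Hausdorff, second countable, on `ℝ⁴`) with a `C^∞` embedding `ι : M → ℝ⁵`
(`Manifold.IsSmoothEmbedding`), i.e. a closed connected embedded hypersurface `ι(M) ⊂ ℝ⁵`:

* (a) if `λ(ι(M)) ≤ λ(shrinkingCylinder 4 3)` (the self-shrinking `𝕊³(√6) × ℝ ⊂ ℝ⁵`; its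
  entropy is `λ(𝕊³)` by `Stone1994_cylinderEntropy`) then `M` is diffeomorphic to the standard
  `𝕊⁴ ⊂ ℝ⁵` — from the printed
  "smooth isotopy from `M` to a standard `𝕊⁴`" we keep only its endpoint: an isotopy of embeddings
  ends at an embedding of `M` onto a round sphere;
* (b) if `λ(ι(M)) ≤ λ(shrinkingCylinder 4 2)` (`𝕊²(2) × ℝ²`; entropy `λ(𝕊²) = 4/e`) and `M` is SIMPLY
  CONNECTED, then `M` is diffeomorphic to `𝕊⁴` — from the printed isotopy to `∂(B⁵)` or
  `∂(♮ₖ B⁴ × 𝕊¹) = #ₖ 𝕊¹ × 𝕊³`, whose fundamental group is free of rank `k`, so that for simply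
  connected `M` only the standard ball occurs; this is the statement "a homotopy `4`-sphere embedded
  in `ℝ⁵` with `λ ≤ 4/e` is standard", the proved rung below the route's threshold `λ(𝕊¹ × ℝ³)`.

Both clauses are consequences of the printed corollary together with classical facts (endpoint of
an isotopy; `π₁(#ₖ 𝕊¹ × 𝕊³) = F_k`; `λ(𝕊ᵏ × ℝ⁴⁻ᵏ) = λ(𝕊ᵏ)`), hence WEAKER than the source, never
stronger; the isotopy itself, the handlebody classification in (b) for non-simply-connected `M`,
the cases `n = 2, 3, 5`, Thm. 1.3 / Cor. 1.19 (generic flows have only `𝕊⁴, 𝕊³×ℝ, 𝕊²×ℝ², 𝕊¹×ℝ³`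
singularities) and Cor. 1.23 (a.e.-time smoothness) are NOT vendored: the tree has no mean
curvature flow (Brakke / level-set flows, singular sets, surgery).

**How the entropy is written.** `λ = gaussianEntropy 4` (`ColdingMinicozziEntropy.lean`), the
thresholds being the entropies of the self-shrinking generalised cylinders
`shrinkingCylinder 4 k = 𝕊ᵏ(√(2k)) × ℝ⁴⁻ᵏ ⊂ ℝ⁵` (`ColdingMinicozziEntropyValues.lean`); that these
equal the printed numbers `λ(𝕊ᵏ)` (`λ(𝕊³) ≈ 1.4531`, `λ(𝕊²) = 4/e`) is the named fact
`Stone1994_cylinderEntropy` of that file (Stone 1994; Colding–Minicozzi 2012, Lemma 7.10) — so the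
reading "`λ(M) ≤ λ(𝕊³)`" of hypothesis (a) rests on that fact, while the statement itself only
compares entropies of subsets of `ℝ⁵` and needs no normalisation. The route's items write entropy
inequalities with the inline un-normalised functional `⨆ p t (0<t), (ofReal (t^2))⁻¹ * ∫⁻ x in A,
ofReal (exp (-‖x-p‖²/(4t))) ∂μH[4]`; `of_inline_le` below converts (via
`gaussianEntropy_le_gaussianEntropy_iff` and `shrinkingCylinder_four_two`).

## References

* [ChodoshMantoulidisSchulze2025] O. Chodosh, C. Mantoulidis, F. Schulze, arXiv:2309.03856 /
  Duke Math. J. 2025: Thm. 1.3, Cor. 1.5, Thm. 1.17, Cor. 1.19, Cor. 1.22 (proof p. 6), Cor. 1.23.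
* [DanielsHolgate2022] J. M. Daniels-Holgate, *Approximation of mean curvature flow with generic
  singularities by smooth flows with surgery*, Adv. Math. 410 (2022) (the surgery in (b)).
* [ColdingMinicozzi2012] T. H. Colding, W. P. Minicozzi II, Ann. of Math. 175 (2012), (0.5)–(0.6),
  Remark 1.7, Lemma 7.10 (entropy; values on spheres and cylinders). [Stone1994]
-/

noncomputable section

open Set MeasureTheory
open scoped Manifold ContDiff ENNReal

namespace Literature.Geometry.Riemannian

/-- `shrinkingCylinder 4 2 = {y | y₀² + y₁² + y₂² = 4} = 𝕊²(2) × ℝ²`, the threshold set of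
Cor. 1.5 (b) for `n = 4` (unfolding, in the style of `shrinkingCylinder_four_one`).
[cite: ColdingMinicozzi2012, p. 758] -/
theorem shrinkingCylinder_four_two :
    shrinkingCylinder 4 2 = {y : EuclideanSpace ℝ (Fin 5) | y 0 ^ 2 + y 1 ^ 2 + y 2 ^ 2 = 4} := by
  show shrinkingCylinder 4 2 = {y : EuclideanSpace ℝ (Fin (4 + 1)) | y 0 ^ 2 + y 1 ^ 2 + y 2 ^ 2 = 4}
  ext y
  simp only [mem_shrinkingCylinder, Set.mem_setOf_eq, Fin.sum_univ_succ, Fin.sum_univ_zero,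
    Fin.val_zero, Fin.val_succ, Fin.succ_zero_eq_one]
  norm_num [Fin.succ]
  show y 0 ^ 2 + (y 1 ^ 2 + y 2 ^ 2) = 4 ↔ y 0 ^ 2 + y 1 ^ 2 + y 2 ^ 2 = 4
  rw [← add_assoc]

/-- `shrinkingCylinder 4 3 = {y | y₀² + y₁² + y₂² + y₃² = 6} = 𝕊³(√6) × ℝ`, the threshold set of
Cor. 1.5 (a) for `n = 4`. [cite: ColdingMinicozzi2012, p. 758] -/
theorem shrinkingCylinder_four_three :
    shrinkingCylinder 4 3 =
      {y : EuclideanSpace ℝ (Fin 5) | y 0 ^ 2 + y 1 ^ 2 + y 2 ^ 2 + y 3 ^ 2 = 6} := by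
  show shrinkingCylinder 4 3 =
    {y : EuclideanSpace ℝ (Fin (4 + 1)) | y 0 ^ 2 + y 1 ^ 2 + y 2 ^ 2 + y 3 ^ 2 = 6}
  ext y
  simp only [mem_shrinkingCylinder, Set.mem_setOf_eq, Fin.sum_univ_succ, Fin.sum_univ_zero,
    Fin.val_zero, Fin.val_succ, Fin.succ_zero_eq_one]
  norm_num [Fin.succ]
  show y 0 ^ 2 + (y 1 ^ 2 + (y 2 ^ 2 + y 3 ^ 2)) = 6 ↔ y 0 ^ 2 + y 1 ^ 2 + y 2 ^ 2 + y 3 ^ 2 = 6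
  rw [← add_assoc, ← add_assoc]

/-- **Chodosh–Mantoulidis–Schulze 2025, Cor. 1.5 (= Cor. 1.22, unconditional for `n ≤ 5`), case
`n = 4`, diffeomorphism consequences** — NAMED FACT (statement only, D-0014), the conjunction of:
(a) "If `λ(M) ≤ λ(𝕊³)` then perhaps after a small initial `C^∞` perturbation, the mean curvature
flow provides a smooth isotopy from `M` to a standard `𝕊⁴` in `ℝ⁵`" — rendered: a compact connected
`C^∞` `4`-manifold `M` with a `C^∞` embedding `ι : M → ℝ⁵` whose image has entropy
`λ(ι(M)) ≤ λ(shrinkingCylinder 4 3) = λ(𝕊³(√6) × ℝ)` (`gaussianEntropy 4`; equal to the printed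
`λ(𝕊³)` by the named fact `Stone1994_cylinderEntropy`) is diffeomorphic to the standard `𝕊⁴`; and
(b) "If `λ(M) ≤ λ(𝕊²)` then […] the mean curvature flow with surgery of Daniels-Holgate provides a
smooth isotopy from `M` to the boundary of a standard handlebody that is either a standard ball
`B⁵` or a boundary connect sum of finitely many `B⁴ × 𝕊¹`'s" — rendered for SIMPLY CONNECTED `M`
(for which only `∂B⁵ = 𝕊⁴` can occur, `π₁(#ₖ 𝕊¹ × 𝕊³)` being free of rank `k`): if moreover
`λ(ι(M)) ≤ λ(shrinkingCylinder 4 2) = λ(𝕊²(2) × ℝ²)` (`= 4/e` by `Stone1994_cylinderEntropy`) then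
`M` is diffeomorphic to `𝕊⁴`.
Weaker than print (isotopies and the handlebody alternative dropped; thresholds as entropies of
the shrinking cylinders in `ℝ⁵`, equal to `λ(𝕊ᵏ)` by the named fact `Stone1994_cylinderEntropy`); the
mean-curvature-flow statements Thm. 1.3, Cor. 1.19, Cor. 1.23 are not vendored (no MCF in the tree).
[cite: ChodoshMantoulidisSchulze2025, Cor. 1.5 (a), (b) and Cor. 1.22 (n = 4)]
[cite: DanielsHolgate2022] -/
def ChodoshMantoulidisSchulze2025_lowEntropy_sphere_four : Prop :=
  (∀ (M : Type) [TopologicalSpace M] [T2Space M] [SecondCountableTopology M] [CompactSpace M]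
      [ConnectedSpace M] [ChartedSpace (EuclideanSpace ℝ (Fin 4)) M] [IsManifold (𝓡 4) ∞ M]
      (ι : M → EuclideanSpace ℝ (Fin 5)), Manifold.IsSmoothEmbedding (𝓡 4) (𝓡 5) ∞ ι →
      gaussianEntropy 4 (range ι) ≤ gaussianEntropy 4 (shrinkingCylinder 4 3) →
        Nonempty (M ≃ₘ⟮𝓡 4, 𝓡 4⟯ (Metric.sphere (0 : EuclideanSpace ℝ (Fin 5)) 1))) ∧
  (∀ (M : Type) [TopologicalSpace M] [T2Space M] [SecondCountableTopology M] [CompactSpace M]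
      [ConnectedSpace M] [ChartedSpace (EuclideanSpace ℝ (Fin 4)) M] [IsManifold (𝓡 4) ∞ M],
      SimplyConnectedSpace M → ∀ (ι : M → EuclideanSpace ℝ (Fin 5)),
      Manifold.IsSmoothEmbedding (𝓡 4) (𝓡 5) ∞ ι →
      gaussianEntropy 4 (range ι) ≤ gaussianEntropy 4 (shrinkingCylinder 4 2) →
        Nonempty (M ≃ₘ⟮𝓡 4, 𝓡 4⟯ (Metric.sphere (0 : EuclideanSpace ℝ (Fin 5)) 1)))

/-- **Cor. 1.5 (a), `n = 4`:** a closed connected embedded hypersurface of `ℝ⁵` with entropy at most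
`λ(𝕊³ × ℝ) = λ(𝕊³)` is diffeomorphic to `𝕊⁴` (first conjunct of the fact).
[cite: ChodoshMantoulidisSchulze2025, Cor. 1.5 (a)] -/
theorem ChodoshMantoulidisSchulze2025_lowEntropy_sphere_four.of_le_shrinkingCylinder_three
    (h : ChodoshMantoulidisSchulze2025_lowEntropy_sphere_four)
    (M : Type) [TopologicalSpace M] [T2Space M] [SecondCountableTopology M] [CompactSpace M]
    [ConnectedSpace M] [ChartedSpace (EuclideanSpace ℝ (Fin 4)) M] [IsManifold (𝓡 4) ∞ M]
    {ι : M → EuclideanSpace ℝ (Fin 5)} (hι : Manifold.IsSmoothEmbedding (𝓡 4) (𝓡 5) ∞ ι)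
    (hent : gaussianEntropy 4 (range ι) ≤ gaussianEntropy 4 (shrinkingCylinder 4 3)) :
    Nonempty (M ≃ₘ⟮𝓡 4, 𝓡 4⟯ (Metric.sphere (0 : EuclideanSpace ℝ (Fin 5)) 1)) :=
  h.1 M ι hι hent

/-- **Cor. 1.5 (b), `n = 4`, for homotopy spheres:** a simply connected closed embedded
hypersurface of `ℝ⁵` with entropy at most `λ(𝕊² × ℝ²) = λ(𝕊²) = 4/e` is diffeomorphic to `𝕊⁴`
(second conjunct of the fact). [cite: ChodoshMantoulidisSchulze2025, Cor. 1.5 (b)] -/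
theorem ChodoshMantoulidisSchulze2025_lowEntropy_sphere_four.of_le_shrinkingCylinder_two
    (h : ChodoshMantoulidisSchulze2025_lowEntropy_sphere_four)
    (M : Type) [TopologicalSpace M] [T2Space M] [SecondCountableTopology M] [CompactSpace M]
    [ConnectedSpace M] [ChartedSpace (EuclideanSpace ℝ (Fin 4)) M] [IsManifold (𝓡 4) ∞ M]
    (hsc : SimplyConnectedSpace M) {ι : M → EuclideanSpace ℝ (Fin 5)}
    (hι : Manifold.IsSmoothEmbedding (𝓡 4) (𝓡 5) ∞ ι)
    (hent : gaussianEntropy 4 (range ι) ≤ gaussianEntropy 4 (shrinkingCylinder 4 2)) :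
    Nonempty (M ≃ₘ⟮𝓡 4, 𝓡 4⟯ (Metric.sphere (0 : EuclideanSpace ℝ (Fin 5)) 1)) :=
  h.2 M hsc ι hι hent

/-- The route's literal shape for clause (b): the entropy bound by the `𝕊²(2) × ℝ²`-cylinder written
exactly as in the items of `EntropyLadder` (`{y | y₀² + y₁² + y₂² = 4}` and the inline functional)
gives `M ≅ 𝕊⁴` for simply connected `M`. (The route's own threshold is the `𝕊¹ × ℝ³`-cylinder,
`λ(𝕊¹) ≈ 1.5203 > 4/e`: one rung ABOVE this fact.) [cite: ChodoshMantoulidisSchulze2025, Cor. 1.5 (b)] -/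
theorem ChodoshMantoulidisSchulze2025_lowEntropy_sphere_four.of_inline_le
    (h : ChodoshMantoulidisSchulze2025_lowEntropy_sphere_four)
    (M : Type) [TopologicalSpace M] [T2Space M] [SecondCountableTopology M] [CompactSpace M]
    [ConnectedSpace M] [ChartedSpace (EuclideanSpace ℝ (Fin 4)) M] [IsManifold (𝓡 4) ∞ M]
    (hsc : SimplyConnectedSpace M) {ι : M → EuclideanSpace ℝ (Fin 5)}
    (hι : Manifold.IsSmoothEmbedding (𝓡 4) (𝓡 5) ∞ ι)
    (hent : (⨆ (p : EuclideanSpace ℝ (Fin 5)) (t : ℝ) (_ : 0 < t),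
        (ENNReal.ofReal (t ^ 2))⁻¹ *
          ∫⁻ x in range ι, ENNReal.ofReal (Real.exp (-(‖x - p‖ ^ 2) / (4 * t))) ∂μH[4]) ≤
      (⨆ (p : EuclideanSpace ℝ (Fin 5)) (t : ℝ) (_ : 0 < t),
        (ENNReal.ofReal (t ^ 2))⁻¹ *
          ∫⁻ x in {y : EuclideanSpace ℝ (Fin 5) | y 0 ^ 2 + y 1 ^ 2 + y 2 ^ 2 = 4},
            ENNReal.ofReal (Real.exp (-(‖x - p‖ ^ 2) / (4 * t))) ∂μH[4])) :
    Nonempty (M ≃ₘ⟮𝓡 4, 𝓡 4⟯ (Metric.sphere (0 : EuclideanSpace ℝ (Fin 5)) 1)) := by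
  refine h.of_le_shrinkingCylinder_two M hsc hι ?_
  have h2 : ∀ t : ℝ, t ^ ((4 : ℝ) / 2) = t ^ 2 := fun t => by
    rw [show ((4 : ℝ) / 2) = (2 : ℕ) by norm_num, Real.rpow_natCast]
  rw [gaussianEntropy_le_gaussianEntropy_iff, shrinkingCylinder_four_two]
  simp only [Nat.cast_ofNat, h2]
  exact hent

end Literature.Geometry.Riemannian

end
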